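import Summits.AnomalousDissipation.AnomalousDissipation.Theorems.MarginalStabilityChainChainRealisationStubLoudOfContrast
import Summits.AnomalousDissipation.AnomalousDissipation.Theorems.MarginalStabilityChainChainRealisationReduction
import HarnessLib

/-!
# Crux-triage r1-1 checks — crux stmt-AnomalousDissipation-14249 (`MarginalStabilityChain.ChainRealisation`)

Kernel-checked anchors for the three verdicts of `TRIAGE-r1-1.md` (triager 1 of 2, round 1).  Nothing here is
new mathematics; each item pins one sentence of the triage to a theorem.

* §0 `crux_is_target_modulo_h2` — the state of the crux (re-export of the landed reduction p111632 /
  domination p116771): under `StrainedLayerLaw`, closing the crux through ANY residual `R` is proving the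
  route target `ChainThesis` from `R`.  None of the three cards attacks `StrainedLayerLaw`; so each is graded
  as a plan for `ChainThesis`, whose surplus over "loud + bounded forward family for ONE force" is ALREADY a
  theorem (`chainThesis_of_forwardFamilyZM_holds`, p105517).
* §A `loud_iff_injectionFloor` — for every steady smooth force and every forward classical trajectory with a
  forward energy bound, the dissipation floor `ε ≤ ⟨ν‖∇u‖²⟩` IS the injection floor
  `ε ≤ limsup_T T⁻¹∫₀ᵀ(f, u(t))dt`, a signed first moment of the (Cesàro-)mean field.  Hence a residual of the
  form "bounded energy + injection/contrast/flux floor" (card `separatrix-flux-pinning`'s `ContrastFamily`,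
  card `three-clocks-fat-core-ladder`'s level-0 feeding, card `layer-generation-relay`'s FEED ∧ FLUXFLOOR in
  the mean) restates loudness; and card 3's why-easier (a) ("a signed first moment of a mean field, measurable
  in one DNS") holds verbatim for the summit with ANY force.
* §B `injectionOnly_hasDerivAt`, `injectionOnly_unbounded` — card `layer-generation-relay`, why-easier (2)
  ("the energy ceiling is no longer a hypothesis: it is `drain_ceiling` applied to FLUXFLOOR").  The PROVED
  `drain_ceiling` needs `e' ≤ F√e − κe√e` at EVERY time; FLUXFLOOR gives the drain only on admissible windows
  of lower DENSITY `≥ p₀` (FEED).  Off those windows the comparison ODE is pure injection `e' = F√e`, solved by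
  `e(t) = (Ft/2)²`, unbounded: with admissible windows `[kτ, kτ + p₀τ] (period τ)` the density stays `≥ p₀` at
  every scale while `sup e ≥ (F(1-p₀)τ/2)² → ∞` and the cycle-mean energy `≳ F²(1-p₀)³τ²/12 → ∞` as `τ → ∞`.
  So the ceiling is NOT deleted: it returns as a `ν`-UNIFORM GAP BOUND (syndetic recurrence) inside FEED.
* §C `ladder_floor_vanishes` — card `three-clocks-fat-core-ladder`, ladder sum (S): with level-independent
  retention `θ = θ₁θ₂ < 1` from (R1),(R2) and depth `K(ν) ≍ log Re → ∞`, the stated floor `(θ₁θ₂)^K Π₀`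
  tends to `0`; the card's "≥ ε iff Σ_k (1 − θ₁θ₂)_k < ∞" is a FIFTH, level-dependent conjecture (retention
  → 1 down the ladder) not supplied by R1/R2 as stated.
-/

set_option linter.dupNamespace false

noncomputable section

namespace Summit.AnomalousDissipation.AnomalousDissipation.Cruxes.ChainRealisation.Triage1

open MeasureTheory Set Filter Topology
open scoped InnerProductSpace
open Literature.Analysis.FunctionSpaces Literature.Analysis.FunctionSpaces.Torus
open Literature.Analysis.FluidPDE
open Summit.AnomalousDissipation.AnomalousDissipation.Theses.MarginalStabilityChain
open Summit.AnomalousDissipation.AnomalousDissipation.Theorems.ChainRealisation.SeparatrixFluxPinning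
  (meanDissipation_eq_longTimeAvgSup_inner)
open Summit.AnomalousDissipation.AnomalousDissipation.Theorems.ChainRealisation (Reduction.chainRealisation_iff_chainThesis_of
  Reduction.chainRealisation_of_chainThesis)

/-! ## §0 The crux is the target modulo `StrainedLayerLaw` (re-derived from the landed reduction p111632; = p116771) -/

/-- Under the single-layer law, a residual closes the crux iff it proves the route target. [folklore] -/
theorem crux_is_target_modulo_h2 (R : Prop) (h2 : StrainedLayerLaw) :
    (R → ChainRealisation) ↔ (R → ChainThesis) :=
  ⟨fun hR r => (Reduction.chainRealisation_iff_chainThesis_of h2).1 (hR r),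
    fun hR r => Reduction.chainRealisation_of_chainThesis (hR r)⟩

/-! ## §A Loudness is already an injection floor = a signed first moment of the mean field -/

/-- **LOUD ⇔ INJECTION FLOOR** for every steady smooth force: along a forward classical trajectory with a
forward energy bound, `ε ≤ meanDissipation ν u ↔ ε ≤ limsup_T T⁻¹∫₀ᵀ ∫⟪f, u(t)⟫` (landed energy-equality
budget `meanDissipation_eq_longTimeAvgSup_inner`, p88369). [folklore] -/
theorem loud_iff_injectionFloor {d : Type*} [Fintype d] [DecidableEq d] {ν ε : ℝ}
    {f : UnitAddTorus d → EuclideanSpace ℝ d}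
    {u : ℝ → UnitAddTorus d → EuclideanSpace ℝ d} {p : ℝ → UnitAddTorus d → ℝ}
    (h : IsClassicalNSSolutionOn (Ici 0) ν (fun _ => f) u p) (hf : IsSmooth f)
    {C : ℝ} (hC : ∀ t : ℝ, 0 ≤ t → ∫ x, ‖u t x‖ ^ 2 ≤ C) :
    ε ≤ meanDissipation ν u ↔ ε ≤ longTimeAvgSup (fun t => ∫ x, ⟪f x, u t x⟫_ℝ) := by
  rw [meanDissipation_eq_longTimeAvgSup_inner h hf hC]

/-! ## §B Card `layer-generation-relay`: no drain off the admissible windows -/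

/-- Off the admissible windows the comparison ODE of `drain_ceiling` is pure injection `e' = F√e`;
`e(t) = (Ft/2)²` solves it on `t ≥ 0`. [folklore] -/
theorem injectionOnly_hasDerivAt (F : ℝ) (hF : 0 ≤ F) {t : ℝ} (ht : 0 ≤ t) :
    HasDerivAt (fun s : ℝ => (F * s / 2) ^ 2) (F * Real.sqrt ((F * t / 2) ^ 2)) t := by
  have h1 : HasDerivAt (fun s : ℝ => F * s / 2) (F / 2) t := by
    simpa using ((hasDerivAt_id t).const_mul F).div_const 2
  have h2 : HasDerivAt (fun s : ℝ => (F * s / 2) ^ 2) (((2 : ℕ) : ℝ) * (F * t / 2) ^ (2 - 1) * (F / 2)) t :=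
    h1.pow 2
  have h3 : ((2 : ℕ) : ℝ) * (F * t / 2) ^ (2 - 1) * (F / 2) = F * Real.sqrt ((F * t / 2) ^ 2) := by
    rw [Real.sqrt_sq (by positivity), show (2 - 1 : ℕ) = 1 from rfl, pow_one, Nat.cast_ofNat]
    ring
  rw [h3] at h2
  exact h2

/-- … and that solution exceeds every bound: a density-`p₀` admissibility (FEED) with unbounded gaps gives
no `ν`-uniform ceiling. [folklore] -/
theorem injectionOnly_unbounded {F : ℝ} (hF : 0 < F) (B : ℝ) :
    ∃ t : ℝ, 0 ≤ t ∧ B < (F * t / 2) ^ 2 := by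
  refine ⟨2 * (|B| + 1) / F, by positivity, ?_⟩
  have h : F * (2 * (|B| + 1) / F) / 2 = |B| + 1 := by
    field_simp
  rw [h]
  nlinarith [le_abs_self B, abs_nonneg B]

/-! ## §C Card `three-clocks-fat-core-ladder`: constant retention kills the ladder floor -/

/-- With level-independent retention `0 ≤ θ < 1` and depth `K → ∞` the ladder floor `θ^K P₀ → 0`. [folklore] -/
theorem ladder_floor_vanishes {θ : ℝ} (h0 : 0 ≤ θ) (h1 : θ < 1) (P₀ : ℝ) :
    Tendsto (fun K : ℕ => θ ^ K * P₀) atTop (nhds 0) := by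
  simpa using (tendsto_pow_atTop_nhds_zero_of_lt_one h0 h1).mul_const P₀

end Summit.AnomalousDissipation.AnomalousDissipation.Cruxes.ChainRealisation.Triage1

end
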